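import Literature.AnabelianGeometry.SemiGraphs.PSCSeparatingCoveringsTwoComponentUnmarkedEdges
import Literature.AnabelianGeometry.SemiGraphs.PSCIrreducibleNodalOrigin
import HarnessLib

/-!
# [CombGC] Prop. 1.2, proof p. 9: EDGE-LIKE separating coverings at the ONE-CUSP irreducible nodal datum by a LEVEL — the pointed nodal cubic `Γ_{1,1}` included (row F-2827)

Mochizuki, *A combinatorial version of the Grothendieck conjecture*, Tohoku Math. J. **59** (2007)
[CombGC], PROOF of Proposition 1.2, author's manuscript p. 9, the resp'd (edge) case: "[possibly replacing
`G` by some finite étale covering of `G`] … there exists a finite étale … `Π_G`-covering `G' → G` whose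
restriction to the anabelioid `G_{e₂}` is trivial, but whose restriction to the anabelioid `G_{e₁}` is
nontrivial" [cite: MochizukiCombGC2007, Prop 1.2 proof p.9]; typed LEVEL-WISE as
`PSCDatum.EdgeLikeSeparatingCoverings` (abc-iut-w4-d081, row P12-L01-E; abc-iut FACT-LIST row F-2827 — a
schema whose universal closure is refuted as typed; the instance forms at genuine carriers are the content).

PROOF-ONLY file (abc-iut-f-166 gen 6; 0 definitions).  The carrier: abc-iut-f-164's IRREDUCIBLE ONE-NODAL
datum with ONE marked point (one vertex with a loop; `ι : Γ_{g,1} → Π` a profinite pro-`Σ` completion,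
`g ≥ 1`; node group `cl ι⟨b₀⟩`, cusp group `cl ι⟨c₀⟩`, `c₀ = (∏_i [a_i,b_i])⁻¹`).  At `g = 1` — the pointed
nodal cubic `Γ_{1,1} = F(a₀, b₀)`, `c₀ = [a₀,b₀]⁻¹ ∈ ⟨⟨b₀⟩⟩` — NO open `U` normal in the whole group can kill the
node and see the cusp: the separating level `V'` of the typed statement must be a PROPER covering (abc-iut-f-060
gen 9 and gen 6 of this seat, census (4); abc-iut-f-060's cusp/loop twists give `g ≥ 2`).  This file takes
"replacing `G` by a finite étale covering" literally, through gen 5's SHAPE-INDEPENDENT assembly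
`edgeLikeSeparatingCoverings_of_levelCertificates'` (`PSCSeparatingCoveringsLevelEdges.lean`): at the
`ℤ/ℓ²`-level `Π₀ = cl ι(Ker χ)`, `χ = a₀^∨ mod ℓ²` (`ℓ ∈ Σ`), with abc-iut-w5-d174's Schreier basis
`Y_{x,k} = a₀^k x a₀^{-k}`, `T = a₀^{ℓ²}`, the node letter `b₀ = Y_{b₀,0}` and the cusp
`c₀ = Y_{b₀,0} Y_{b₀,1}⁻¹ · (level commutators)` are INDEPENDENT (`c₀` is itself a level basis member, gen 5's
`exists_levelBasis_cuspZero` with `g₀ := 0`), and every certificate is an ABELIAN character of the level: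
sums of the duals `Y_{b₀,k}^∨` (readings `hom_conj_letter_eq`, `hom_conj_cuspZero_eq`:
`ψ(a₀^m b₀ a₀^{-m}) = ψ(Y_{b₀,m})`, `ψ(a₀^m c₀ a₀^{-m}) = (ψ(Y_{b₀,m+1}) ψ(Y_{b₀,m})⁻¹)⁻¹`; `ℓ² ≥ 4` letters
around the cycle are what the cusp/cusp pair with shift `m = 1` needs).  The separating level is
`V' := V ∩ Π₀ < V`.

* `edgeLikeSeparatingCoverings_of_irreducibleNodalOneCusp_level` — **F-2827 at EVERY one-cusp irreducible
  nodal datum, `g ≥ 1`** (at `g ≥ 2` a second proof, by a different route, of abc-iut-f-060's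
  `edgeLikeSeparatingCoverings_of_irreducibleNodalOneCusp`; NEW at `g = 1`);
* `exists_irreducibleNodalCubic_edgeLikeSeparatingCoverings` — NON-VACUITY at the corner: an inhabited datum
  over `Γ_{1,1}` (the pointed nodal cubic) carrying F-2827, for every nonempty set `Σ` of primes.

(F-2826 at `Γ_{1,1}` — the vertex group `cl ι⟨b₀, a₀b₀a₀⁻¹⟩ = cl ι⟨Y_{b₀,0}, Y_{b₀,1}⟩` is a LEVEL free factor
too — is the natural sequel.)  Instance forms at data of the shape of genuine stable curves: consistency
evidence for the typed schema, not the printed theorem for all pointed stable curves.  Nothing here takes a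
side on [IUTchIII] Cor. 3.12.
-/

noncomputable section

namespace Literature.AnabelianGeometry.SemiGraphs

namespace PSCDatum

open scoped Pointwise
open Multiplicative
open Literature.AnabelianGeometry.Anabelioids (IsSigmaInteger)
open Literature.GroupTheory.CombinatorialGroupTheory
open Literature.GroupTheory.CombinatorialGroupTheory.PuncturedSurfaceGroup
open Literature.GroupTheory.CombinatorialGroupTheory.FreeFactorFibredTwist (lift_apply_basis)
open SemiGraphOfAnabelioids (IsProSigmaCompletion)
open SemiGraphOfAnabelioids.IsProSigmaCompletion (normal_of_comap_normal isSigmaInteger_prime_pow)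

section Datum

variable {P : Type} [Group P] [TopologicalSpace P] [IsTopologicalGroup P]
variable [CompactSpace P] [TotallyDisconnectedSpace P] {Sigma : Set ℕ} {g r : ℕ}

/-- **Row P12-L01-E / F-2827 (`EdgeLikeSeparatingCoverings`) at EVERY irreducible one-nodal datum with ONE
marked point, by a level** (`g ≥ 1`; the pointed nodal cubic `Γ_{1,1}` included): separating level
`V' := V ∩ Π₀`, `Π₀` the `ℤ/ℓ²`-level of the character `a₀^∨`; node letter and cusp word are independent
members of level free bases and all certificates are abelian. [cite: MochizukiCombGC2007, Prop 1.2 proof p.9] -/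
theorem edgeLikeSeparatingCoverings_of_irreducibleNodalOneCusp_level (hne : Sigma.Nonempty)
    (hprime : ∀ p ∈ Sigma, p.Prime) (ι : PuncturedSurfaceGroup g (r + 1) →* P)
    (hι : IsProSigmaCompletion Sigma ι) (G : PSCDatum P) (hg : 1 ≤ g) (hr : r = 0)
    (e : G.graph.C ≃ Fin (r + 1))
    (hC : ∀ c', G.cuspGp c' = ((cuspInertia (g := g) (e c')).map ι).topologicalClosure)
    (n₀ : G.graph.N) (hN : ∀ n, n = n₀)
    (hE : G.nodeGp n₀ = ((Subgroup.zpowers (PuncturedSurfaceGroup.b (r := r + 1) (⟨0, hg⟩ : Fin g))).map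
      ι).topologicalClosure) :
    G.EdgeLikeSeparatingCoverings := by
  classical
  subst hr
  have hg0 : (0 : ℕ) < g := hg
  obtain ⟨ℓ, hℓS⟩ := hne
  have hℓ : ℓ.Prime := hprime ℓ hℓS
  -- the level exponent `n = ℓ²` (at least `4`)
  have hℓ2 : 2 ≤ ℓ := hℓ.two_le
  have hn3 : 3 ≤ ℓ ^ 2 := by nlinarith
  haveI : NeZero (ℓ ^ 2) := ⟨by positivity⟩
  haveI : Fact (1 < ℓ ^ 2) := ⟨by omega⟩
  obtain ⟨b₀, ha, hb, hc⟩ := exists_freeGroupBasis_elim_zero g 0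
  -- the level character `a₀ ↦ 1`
  obtain ⟨χ, hχa', hχb', hχc'⟩ := exists_handleCuspCharacter (g := g) (r := 0 + 1) (n := ℓ ^ 2)
    (fun i => if (i : ℕ) = 0 then 1 else 0) (fun _ => 0) (fun _ => 0) (by simp)
  have hχa : ∀ i : Fin g, χ (a i) = if (i : ℕ) = 0 then ofAdd 1 else 1 := fun i => by
    rw [hχa']; split_ifs <;> rfl
  have hχb : ∀ i : Fin g, χ (b i) = 1 := fun i => by rw [hχb']; rfl
  have hχc : ∀ j : Fin (0 + 1), χ (c j) = 1 := fun j => by rw [hχc']; rfl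
  have ht : χ (a ⟨0, hg0⟩) = ofAdd 1 := by rw [hχa, if_pos rfl]
  have hχbasis := levelCharacter_basis hg0 b₀ ha hb hc χ hχa hχb hχc
  obtain ⟨bK, hbK, hbKT⟩ :=
    FreeGroupBasis.exists_freeGroupBasis_cyclicKernel b₀ (Sum.inl (⟨0, hg0⟩, false)) (ℓ ^ 2) χ hχbasis
  -- the open level
  have hidx : Anabelioids.IsSigmaInteger Sigma χ.ker.index := by
    rw [FreeGroupBasis.index_cyclicKernel b₀ _ (ℓ ^ 2) χ hχbasis]
    exact isSigmaInteger_prime_pow hℓ hℓS 2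
  obtain ⟨P₀, hP₀o, hP₀K⟩ := hι.comap_surj χ.ker inferInstance hidx
  haveI : P₀.Normal := normal_of_comap_normal hι P₀ hP₀o (by rw [hP₀K]; infer_instance)
  -- the edge generators: the loop letter `b₀` and the cusp `c₀`
  obtain ⟨x, hxn, hxc⟩ : ∃ x : G.graph.N ⊕ G.graph.C → PuncturedSurfaceGroup g (0 + 1),
      (∀ n, x (Sum.inl n) = b ⟨0, hg0⟩) ∧ ∀ c', x (Sum.inr c') = c 0 :=
    ⟨Sum.elim (fun _ => b ⟨0, hg0⟩) fun _ => c 0, fun _ => rfl, fun _ => rfl⟩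
  have hbK₀ : b (r := 0 + 1) ⟨0, hg0⟩ ∈ χ.ker := by rw [MonoidHom.mem_ker, hχb]
  have hc0K : c (g := g) (0 : Fin (0 + 1)) ∈ χ.ker := c_mem_levelKer χ hχc 0
  have hx : ∀ e', x e' ∈ χ.ker := by
    rintro (n | c')
    · rw [hxn]; exact hbK₀
    · rw [hxc]; exact hc0K
  have hconj : ∀ {u : PuncturedSurfaceGroup g (0 + 1)}, u ∈ χ.ker → ∀ m : ℕ,
      a ⟨0, hg0⟩ ^ m * u * (a ⟨0, hg0⟩ ^ m)⁻¹ ∈ χ.ker := fun hu m => (MonoidHom.normal_ker χ).conj_mem _ hu _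
  have hc0 : ∀ c', e c' = 0 := fun c' => Fin.fin_one_eq_zero (e c')
  -- the `b₀`-letters of the level: `Y k = Y_{b₀,k}`
  set σ : ZMod (ℓ ^ 2) → (({y : (Fin g × Bool) ⊕ Fin 0 // y ≠ Sum.inl (⟨0, hg0⟩, false)} × ZMod (ℓ ^ 2)) ⊕ Unit) :=
    fun k => Sum.inl (⟨Sum.inl (⟨0, hg0⟩, true), by simp⟩, k) with hσ
  have hσinj : ∀ k k', σ k = σ k' ↔ k = k' := fun k k' => by
    rw [hσ]; simp only [Sum.inl.injEq, Prod.mk.injEq, true_and]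
  -- abelian level characters: `ψ_p(Y_{b₀,k}) = [p k]`, all other letters `↦ 0`
  have hchar : ∀ (p : ZMod (ℓ ^ 2) → Prop) [DecidablePred p],
      ∃ ψ : χ.ker →* Multiplicative ℤ, ∀ k : ZMod (ℓ ^ 2), ψ (bK (σ k)) = if p k then ofAdd 1 else 1 := by
    intro p _
    refine ⟨bK.lift fun y => if ∃ k, y = σ k ∧ p k then ofAdd 1 else 1, fun k => ?_⟩
    rw [lift_apply_basis]
    by_cases hk : p k
    · rw [if_pos ⟨k, rfl, hk⟩, if_pos hk]
    · rw [if_neg hk, if_neg]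
      rintro ⟨k', hk', hpk'⟩
      exact hk (((hσinj k k').mp hk') ▸ hpk')
  -- readings of the conjugates of `b₀` and `c₀` in a commutative target
  have hreadB : ∀ (ψ : χ.ker →* Multiplicative ℤ) (m : ℕ) (hm : a ⟨0, hg0⟩ ^ m * b ⟨0, hg0⟩ * (a ⟨0, hg0⟩ ^ m)⁻¹ ∈ χ.ker),
      ψ ⟨a ⟨0, hg0⟩ ^ m * b ⟨0, hg0⟩ * (a ⟨0, hg0⟩ ^ m)⁻¹, hm⟩ = ψ (bK (σ (m : ZMod (ℓ ^ 2)))) := by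
    intro ψ m hm
    have hm' : a ⟨0, hg0⟩ ^ m * b₀ (Sum.inl (⟨0, hg0⟩, true)) * (a ⟨0, hg0⟩ ^ m)⁻¹ ∈ χ.ker := by rwa [hb]
    have := hom_conj_letter_eq hg0 b₀ ha χ bK hbK hbKT ψ (Sum.inl (⟨0, hg0⟩, true)) (by simp) m hm'
    have e1 : (⟨a ⟨0, hg0⟩ ^ m * b ⟨0, hg0⟩ * (a ⟨0, hg0⟩ ^ m)⁻¹, hm⟩ : χ.ker) =
        ⟨a ⟨0, hg0⟩ ^ m * b₀ (Sum.inl (⟨0, hg0⟩, true)) * (a ⟨0, hg0⟩ ^ m)⁻¹, hm'⟩ :=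
      Subtype.ext (by
        change a ⟨0, hg0⟩ ^ m * b ⟨0, hg0⟩ * (a ⟨0, hg0⟩ ^ m)⁻¹ =
          a ⟨0, hg0⟩ ^ m * b₀ (Sum.inl (⟨0, hg0⟩, true)) * (a ⟨0, hg0⟩ ^ m)⁻¹
        rw [hb])
    rw [e1]
    exact this
  have hreadC : ∀ (ψ : χ.ker →* Multiplicative ℤ) (m : ℕ) (hm : a ⟨0, hg0⟩ ^ m * c 0 * (a ⟨0, hg0⟩ ^ m)⁻¹ ∈ χ.ker),
      ψ ⟨a ⟨0, hg0⟩ ^ m * c 0 * (a ⟨0, hg0⟩ ^ m)⁻¹, hm⟩ =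
        (ψ (bK (σ ((m + 1 : ℕ) : ZMod (ℓ ^ 2)))) * (ψ (bK (σ (m : ZMod (ℓ ^ 2)))))⁻¹)⁻¹ := by
    intro ψ m hm
    rw [hom_conj_cuspZero_eq hg0 b₀ ha hb hc χ hχa hχb hχc bK hbK hbKT ψ m hm]
    simp only [List.finRange_zero, List.map_nil, List.prod_nil, mul_one]
    rfl
  -- the `m = 0` forms
  have hB0 : ∀ ψ : χ.ker →* Multiplicative ℤ, ψ ⟨b ⟨0, hg0⟩, hbK₀⟩ = ψ (bK (σ 0)) := fun ψ => by
    have hm0 : a ⟨0, hg0⟩ ^ 0 * b ⟨0, hg0⟩ * (a ⟨0, hg0⟩ ^ 0)⁻¹ ∈ χ.ker := hconj hbK₀ 0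
    have h := hreadB ψ 0 hm0
    rw [Nat.cast_zero] at h
    have e1 : (⟨b ⟨0, hg0⟩, hbK₀⟩ : χ.ker) = ⟨a ⟨0, hg0⟩ ^ 0 * b ⟨0, hg0⟩ * (a ⟨0, hg0⟩ ^ 0)⁻¹, hm0⟩ :=
      Subtype.ext (by
        change b ⟨0, hg0⟩ = a ⟨0, hg0⟩ ^ 0 * b ⟨0, hg0⟩ * (a ⟨0, hg0⟩ ^ 0)⁻¹
        rw [pow_zero, one_mul, inv_one, mul_one])
    rw [e1]
    exact h
  have hC0 : ∀ ψ : χ.ker →* Multiplicative ℤ,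
      ψ ⟨c 0, hc0K⟩ = (ψ (bK (σ 1)) * (ψ (bK (σ 0)))⁻¹)⁻¹ := fun ψ => by
    have hm0 : a ⟨0, hg0⟩ ^ 0 * c 0 * (a ⟨0, hg0⟩ ^ 0)⁻¹ ∈ χ.ker := hconj hc0K 0
    have h := hreadC ψ 0 hm0
    rw [Nat.cast_succ, Nat.cast_zero, zero_add (1 : ZMod (ℓ ^ 2))] at h
    have e1 : (⟨c 0, hc0K⟩ : χ.ker) = ⟨a ⟨0, hg0⟩ ^ 0 * c 0 * (a ⟨0, hg0⟩ ^ 0)⁻¹, hm0⟩ :=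
      Subtype.ext (by
        change c 0 = a ⟨0, hg0⟩ ^ 0 * c 0 * (a ⟨0, hg0⟩ ^ 0)⁻¹
        rw [pow_zero, one_mul, inv_one, mul_one])
    rw [e1]
    exact h
  -- casts of small numbers in `ℤ/ℓ²`
  have hcast : ∀ m₁ m₂ : ℕ, m₁ < ℓ ^ 2 → m₂ < ℓ ^ 2 →
      (((m₁ : ZMod (ℓ ^ 2)) = (m₂ : ZMod (ℓ ^ 2))) ↔ m₁ = m₂) := fun m₁ m₂ h₁ h₂ => by
    rw [ZMod.natCast_eq_natCast_iff', Nat.mod_eq_of_lt h₁, Nat.mod_eq_of_lt h₂]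
  have hsucc : ∀ m : ℕ, ((m + 1 : ℕ) : ZMod (ℓ ^ 2)) ≠ (m : ZMod (ℓ ^ 2)) := fun m h => by
    rw [Nat.cast_succ, add_eq_left] at h
    exact one_ne_zero h
  have h1ne : (ofAdd (1 : ℤ) : Multiplicative ℤ) ≠ 1 := by decide
  refine G.edgeLikeSeparatingCoverings_of_levelCertificates hι hℓ hℓS P₀ hP₀o χ hP₀K (a ⟨0, hg0⟩) ht x hx
    ?_ ?_ ?_
  · -- edge groups
    rintro (n | c')
    · change G.nodeGp n = _
      rw [hN n, hE, hxn]
    · change G.cuspGp c' = _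
      rw [hC, hxc, hc0 c']; rfl
  · -- level basis members: the letter `Y_{b₀,0}` and gen 5's cusp basis
    rintro (n | c')
    · exact ⟨_, bK, σ 0, by rw [hxn, (levelBasis_zero_handles hg0 b₀ ha hb χ bK hbK ⟨0, hg0⟩).2]⟩
    · obtain ⟨b', hb', -⟩ := exists_levelBasis_cuspZero hg0 b₀ ha hb hc χ hχb hχc bK hbK
      exact ⟨_, b', _, by rw [hb', hxc]⟩
  · -- certificates (all abelian)
    intro e₁ e₂ m hm hne12
    have hmcast0 : m ≠ 0 → ((m : ℕ) : ZMod (ℓ ^ 2)) ≠ 0 := fun hm0 h => by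
      rw [ZMod.natCast_eq_zero_iff] at h
      exact hm0 (Nat.eq_zero_of_dvd_of_lt h hm)
    rcases e₂ with n₂ | c₂ <;> rcases e₁ with n₁ | c₁
    · -- kill `b₀`, keep `a₀^m b₀ a₀^{-m}` (`m ≠ 0`): the dual of `Y_{b₀,m}`
      have hm0 : m ≠ 0 := by
        rcases hne12 with h | h
        · exact absurd (by rw [hN n₁, hN n₂]) h
        · exact h
      obtain ⟨ψ, hψ⟩ := hchar (fun k => k = (m : ZMod (ℓ ^ 2)))
      have v0 : ψ (bK (σ 0)) = 1 := by rw [hψ, if_neg (fun h => hmcast0 hm0 h.symm)]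
      have vm : ψ (bK (σ (m : ZMod (ℓ ^ 2)))) = ofAdd 1 := by rw [hψ, if_pos rfl]
      refine exists_hom_congr_of_eq (hxn n₂) (by rw [hxn]) hbK₀ (hconj hbK₀ m) ⟨ψ, ?_, ?_⟩
      · rw [hB0, v0]
      · rw [hreadB, vm]; exact h1ne
    · -- kill `b₀`, keep `a₀^m c₀ a₀^{-m}`: the dual of `Y_{b₀,1}` (`m = 0`) resp. `Y_{b₀,m}` (`m ≠ 0`)
      by_cases hm0 : m = 0
      · subst hm0
        obtain ⟨ψ, hψ⟩ := hchar (fun k => k = 1)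
        have v0 : ψ (bK (σ 0)) = 1 := by rw [hψ, if_neg zero_ne_one]
        have v1 : ψ (bK (σ 1)) = ofAdd 1 := by rw [hψ, if_pos rfl]
        refine exists_hom_congr_of_eq (hxn n₂) (by rw [hxc]) hbK₀ (hconj hc0K 0) ⟨ψ, ?_, ?_⟩
        · rw [hB0, v0]
        · rw [hreadC, Nat.cast_succ, Nat.cast_zero, zero_add (1 : ZMod (ℓ ^ 2)), v1, v0, inv_one, mul_one,
            Ne, inv_eq_one]
          exact h1ne
      · obtain ⟨ψ, hψ⟩ := hchar (fun k => k = (m : ZMod (ℓ ^ 2)))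
        have v0 : ψ (bK (σ 0)) = 1 := by rw [hψ, if_neg (fun h => hmcast0 hm0 h.symm)]
        have vm : ψ (bK (σ (m : ZMod (ℓ ^ 2)))) = ofAdd 1 := by rw [hψ, if_pos rfl]
        have vm1 : ψ (bK (σ ((m + 1 : ℕ) : ZMod (ℓ ^ 2)))) = 1 := by rw [hψ, if_neg (hsucc m)]
        refine exists_hom_congr_of_eq (hxn n₂) (by rw [hxc]) hbK₀ (hconj hc0K m) ⟨ψ, ?_, ?_⟩
        · rw [hB0, v0]
        · rw [hreadC, vm1, vm, one_mul, inv_inv]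
          exact h1ne
    · -- kill `c₀`, keep `a₀^m b₀ a₀^{-m}`: the all-ones character
      obtain ⟨ψ, hψ⟩ := hchar (fun _ => True)
      have v : ∀ k, ψ (bK (σ k)) = ofAdd 1 := fun k => by rw [hψ, if_pos trivial]
      refine exists_hom_congr_of_eq (hxc c₂) (by rw [hxn]) hc0K (hconj hbK₀ m) ⟨ψ, ?_, ?_⟩
      · rw [hC0, v, v, mul_inv_cancel, inv_one]
      · rw [hreadB, v]; exact h1ne
    · -- kill `c₀`, keep `a₀^m c₀ a₀^{-m}` (`m ≠ 0`)
      have hm0 : m ≠ 0 := by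
        rcases hne12 with h | h
        · exact absurd (by rw [Sum.inr.injEq]; exact e.injective (by rw [hc0, hc0])) h
        · exact h
      by_cases hm1 : m = 1
      · -- shift `1`: the indicator of `{0, 1}`; `Y_{b₀,2}` is a third letter (`ℓ² ≥ 3`)
        subst hm1
        obtain ⟨ψ, hψ⟩ := hchar (fun k => k = 0 ∨ k = 1)
        have v0 : ψ (bK (σ 0)) = ofAdd 1 := by rw [hψ, if_pos (Or.inl rfl)]
        have v1 : ψ (bK (σ ((1 : ℕ) : ZMod (ℓ ^ 2)))) = ofAdd 1 := by
          rw [Nat.cast_one, hψ, if_pos (Or.inr rfl)]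
        have v1' : ψ (bK (σ 1)) = ofAdd 1 := by rw [hψ, if_pos (Or.inr rfl)]
        have v2 : ψ (bK (σ ((1 + 1 : ℕ) : ZMod (ℓ ^ 2)))) = 1 := by
          rw [hψ, if_neg]
          rintro (h | h)
          · exact absurd ((hcast 2 0 (by omega) (by omega)).mp (by rw [Nat.cast_zero]; exact h)) (by omega)
          · exact absurd ((hcast 2 1 (by omega) (by omega)).mp (by rw [Nat.cast_one]; exact h)) (by omega)
        refine exists_hom_congr_of_eq (hxc c₂) (by rw [hxc]) hc0K (hconj hc0K 1) ⟨ψ, ?_, ?_⟩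
        · rw [hC0, v1', v0, mul_inv_cancel, inv_one]
        · rw [hreadC, v2, v1, one_mul, inv_inv]
          exact h1ne
      · -- shift `m ∉ {0,1}`: the dual of `Y_{b₀,m}`
        obtain ⟨ψ, hψ⟩ := hchar (fun k => k = (m : ZMod (ℓ ^ 2)))
        have v0 : ψ (bK (σ 0)) = 1 := by rw [hψ, if_neg (fun h => hmcast0 hm0 h.symm)]
        have v1 : ψ (bK (σ 1)) = 1 := by
          rw [hψ, if_neg]
          intro h
          exact hm1 ((hcast 1 m (by omega) hm).mp (by rw [Nat.cast_one]; exact h)).symm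
        have vm : ψ (bK (σ (m : ZMod (ℓ ^ 2)))) = ofAdd 1 := by rw [hψ, if_pos rfl]
        have vm1 : ψ (bK (σ ((m + 1 : ℕ) : ZMod (ℓ ^ 2)))) = 1 := by rw [hψ, if_neg (hsucc m)]
        refine exists_hom_congr_of_eq (hxc c₂) (by rw [hxc]) hc0K (hconj hc0K m) ⟨ψ, ?_, ?_⟩
        · rw [hC0, v1, v0, inv_one, mul_one, inv_one]
        · rw [hreadC, vm1, vm, one_mul, inv_inv]
          exact h1ne

/-- **Non-vacuity at the pointed nodal cubic**: for every nonempty set `Σ` of primes there is a profinite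
pro-`Σ` datum over `Γ_{1,1}` of irreducible one-nodal shape with ONE marked point (abc-iut-f-164's
`exists_irreducibleNodalDatum Σ 1 1`) carrying `EdgeLikeSeparatingCoverings`. [cite: MochizukiCombGC2007, Prop 1.2 proof p.9] -/
theorem exists_irreducibleNodalCubic_edgeLikeSeparatingCoverings (Sigma : Set ℕ) (hne : Sigma.Nonempty)
    (hprime : ∀ p ∈ Sigma, p.Prime) :
    ∃ (Q : ProfiniteGrp.{0}) (G : PSCDatum Q), G.Sigma = Sigma ∧ G.graph.i = 1 ∧ G.graph.n = 1 ∧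
      G.graph.r = 1 ∧ G.EdgeLikeSeparatingCoverings := by
  obtain ⟨Q, ι, G, e, v₀, n₀, hι, hS, hi, hn, hr, hC, -, hN, hE, -⟩ :=
    exists_irreducibleNodalDatum Sigma hne hprime 1 1 le_rfl
  exact ⟨Q, G, hS, hi, hn, hr,
    G.edgeLikeSeparatingCoverings_of_irreducibleNodalOneCusp_level hne hprime ι hι le_rfl rfl e hC n₀ hN hE⟩

end Datum

end PSCDatum

end Literature.AnabelianGeometry.SemiGraphs

end
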